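import Literature.Barriers.ValiantsHypothesis.BDGIL24LieFromGroup
import Literature.Barriers.ValiantsHypothesis.BDGIL24NaturalProofsMainTheoremProofs
import HarnessLib

/-!
# `U(gl_k)·Δ ⊆ span(GL_k·Δ)`: the circuit cost of `P.Δ` for `P` in the enveloping action
# ([BDGIL24, §5.2 Thm. 5.10], tree-native counterpart via the orbit span) — PROVED
# (`BergEtAl2024.apply_mem_span_orbit_of_mem_adjoin_lieOp`,
#  `BergEtAl2024.affComplexity_apply_le_of_mem_adjoin_lieOp`)

[BDGIL24] = M. van den Berg, P. Dutta, F. Gesmundo, C. Ikenmeyer, V. Lysikov, *Algebraic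
metacomplexity and representation theory*, arXiv:2411.03444, §5.2 (p.29, PDF p.30, p0030.txt:L1–L3):

> **Theorem 5.10.** Let `P ∈ U(gl_k)` be an element of length `L`. Suppose there exists an
> arithmetic circuit `C` of size `s` computing a metapolynomial `Δ : ℂ[x₁,…,x_k]_d → ℂ`. Then there
> exists an arithmetic circuit `C′` of size `O(s L^{2k²})` computing `P.Δ`.

## What is here — and what is NOT

The printed Thm. 5.10 (gate-by-gate simulation of the PBW monomials `X^i`, `|i| ≤ L`, through the
circuit, Lemma 5.9) is NOT typed: its bound is polynomial in the LENGTH `L` of `P` and needs gate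
surgery on circuits. This file proves the tree-native statement that the orbit-span route
(`BDGIL24IsotypicProjectionProofs.lean`, the tree's proof of Thm. 1.1) gives for the SAME objects,
with a bound independent of `L` but exponential in `k²`:

* `apply_mem_span_orbit_of_mem_adjoin_lieOp` — every operator in the subalgebra of `End` generated
  by the `gl_k`-action `lieOp` (the image of `U(gl_k)`; `BDGIL24LieAlgebraAction.lean`) maps
  `span(GL_k·Δ)` into itself (`lieOp_mem_of_stable`, `BDGIL24LieFromGroup.lean`: "the action of
  `G` induces the action of `𝔤`"); in particular `P.Δ ∈ span(GL_k·Δ)`;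
* **`affComplexity_apply_le_of_mem_adjoin_lieOp`** — hence, for `Δ` homogeneous of degree `δ` with
  `cc(Δ) ≤ s`: `cc(P.Δ) ≤ (δd + 1)^{k² − 1} · (s + 2)` for EVERY such `P`, of any length
  (`affComplexity_le_of_mem_span_orbit'`).

So the tree holds: Thm. 5.10's conclusion "`P.Δ` has a small circuit" in the regime `L ≫ δd`
(bound `(δd+1)^{k²−1}(s+2)` vs the printed `O(s L^{2k²})`); the printed `L`-sensitive bound remains
untyped (recorded in the cell's API map). No definitions, no named facts. Honest framing:
bookkeeping; nothing here bears on `VP ≠ VNP`.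

## References
* [BergEtAl2024] arXiv:2411.03444, Thm. 5.10, p.29 (PDF p.30); §5.1.1 p.27.
-/

noncomputable section

open MvPolynomial

namespace Literature.Barriers.ValiantsHypothesis

namespace BergEtAl2024

open Literature.Computability.AlgebraicComplexity Literature.NumberTheory.DiophantineGeometry

variable {k d : ℕ}

/-- **`U(gl_k)` preserves the orbit span**: every operator in the subalgebra of
`End(ℂ[ℂ[x]_d])` generated by the `gl_k`-action `N ↦ lieOp N` maps `span(GL_k·Δ)` into itself.
[cite: BergEtAl2024, §5.1.1 ("The action of G on V induces the action of 𝔤"), p.27 (PDF p.28)] -/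
theorem apply_mem_span_orbit_of_mem_adjoin_lieOp (Δ : MvPolynomial (DegIdx (Fin k) d) ℂ)
    {P : Module.End ℂ (MvPolynomial (DegIdx (Fin k) d) ℂ)}
    (hP : P ∈ Algebra.adjoin ℂ
      (Set.range fun N : Matrix (Fin k) (Fin k) ℂ =>
        (lieOp k d N : Module.End ℂ (MvPolynomial (DegIdx (Fin k) d) ℂ))))
    {F : MvPolynomial (DegIdx (Fin k) d) ℂ}
    (hF : F ∈ Submodule.span ℂ (Set.range fun h : GL (Fin k) ℂ => coordRep (Fin k) ℂ d h Δ)) :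
    P F ∈ Submodule.span ℂ (Set.range fun h : GL (Fin k) ℂ => coordRep (Fin k) ℂ d h Δ) := by
  induction hP using Algebra.adjoin_induction generalizing F with
  | mem P hP =>
    obtain ⟨N, rfl⟩ := hP
    exact lieOp_mem_span_orbit N Δ hF
  | algebraMap c =>
    rw [Module.algebraMap_end_apply]
    exact Submodule.smul_mem _ c hF
  | add P Q _ _ hP hQ =>
    rw [LinearMap.add_apply]
    exact Submodule.add_mem _ (hP hF) (hQ hF)
  | mul P Q _ _ hP hQ =>
    rw [Module.End.mul_apply]
    exact hP (hQ hF)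

/-- In particular `P.Δ ∈ span(GL_k·Δ)` for every `P` in the enveloping action.
[cite: BergEtAl2024, §5.2, p.28 (PDF p.29)] -/
theorem apply_self_mem_span_orbit_of_mem_adjoin_lieOp (Δ : MvPolynomial (DegIdx (Fin k) d) ℂ)
    {P : Module.End ℂ (MvPolynomial (DegIdx (Fin k) d) ℂ)}
    (hP : P ∈ Algebra.adjoin ℂ
      (Set.range fun N : Matrix (Fin k) (Fin k) ℂ =>
        (lieOp k d N : Module.End ℂ (MvPolynomial (DegIdx (Fin k) d) ℂ)))) :
    P Δ ∈ Submodule.span ℂ (Set.range fun h : GL (Fin k) ℂ => coordRep (Fin k) ℂ d h Δ) :=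
  apply_mem_span_orbit_of_mem_adjoin_lieOp Δ hP (self_mem_span_orbit Δ)

/-- **The circuit cost of `P.Δ` for `P` in the enveloping action (tree-native counterpart of
Thm. 5.10).** For a metapolynomial `Δ` of format `(δ, d, k)` with `cc(Δ) ≤ s` and every operator `P`
in the subalgebra generated by the `gl_k`-action (the image of `U(gl_k)`, of ANY length),
`cc(P.Δ) ≤ (δd + 1)^{k² − 1} (s + 2)`. The printed Thm. 5.10 gives instead `O(s L^{2k²})` for `P` of
length `L` by simulating the derivations through the circuit (not typed); the present bound comes
from `P.Δ ∈ span(GL_k·Δ)` and the orbit-span estimate `affComplexity_le_of_mem_span_orbit'`.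
[cite: BergEtAl2024, Thm. 5.10, p.29 (PDF p.30)] locator: paper:arxiv-2411.03444 p0030.txt:L1–L3 -/
theorem affComplexity_apply_le_of_mem_adjoin_lieOp {δ s : ℕ}
    {Δ : MvPolynomial (DegIdx (Fin k) d) ℂ} (hΔ : Δ.IsHomogeneous δ) (hs : affComplexity Δ ≤ s)
    {P : Module.End ℂ (MvPolynomial (DegIdx (Fin k) d) ℂ)}
    (hP : P ∈ Algebra.adjoin ℂ
      (Set.range fun N : Matrix (Fin k) (Fin k) ℂ =>
        (lieOp k d N : Module.End ℂ (MvPolynomial (DegIdx (Fin k) d) ℂ)))) :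
    affComplexity (P Δ) ≤ (δ * d + 1) ^ (k * k - 1) * (s + 2) :=
  affComplexity_le_of_mem_span_orbit' hΔ hs (apply_self_mem_span_orbit_of_mem_adjoin_lieOp Δ hP)

/-- The same for iterated single generators, e.g. the PBW monomials `X^i` of §5.2: any ordered
product of `lieOp`s applied to `Δ` stays in the orbit span and obeys the bound.
[cite: BergEtAl2024, §5.2 (PBW monomials X^i), p.28 (PDF p.29)] -/
theorem affComplexity_list_prod_lieOp_le {δ s : ℕ}
    {Δ : MvPolynomial (DegIdx (Fin k) d) ℂ} (hΔ : Δ.IsHomogeneous δ) (hs : affComplexity Δ ≤ s)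
    (L : List (Matrix (Fin k) (Fin k) ℂ)) :
    affComplexity ((L.map fun N =>
        (lieOp k d N : Module.End ℂ (MvPolynomial (DegIdx (Fin k) d) ℂ))).prod Δ) ≤
      (δ * d + 1) ^ (k * k - 1) * (s + 2) := by
  refine affComplexity_apply_le_of_mem_adjoin_lieOp hΔ hs (Subalgebra.list_prod_mem _ fun P hP => ?_)
  obtain ⟨N, _, rfl⟩ := List.mem_map.1 hP
  exact Algebra.subset_adjoin ⟨N, rfl⟩

end BergEtAl2024

end Literature.Barriers.ValiantsHypothesis
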